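import Summits.HubbardSuperconductivity.HubbardSuperconductivity.Theorems.BirComplexStableXY.Negative.WitnessTable

/-!
# Crux `BirGappedPhaseReductionR` (item `stmt-HubbardSuperconductivity-14846`), negative lane: the all-pairs real XY window table is admissible in the class of the restated engine `BirComplexStableXYR`

Helper file of the standing disprover of crux 4R of route BalabanIR
(`BirGappedPhaseReductionR := BirComplexStableXYR → BirBdGPhaseCoercivity → BirGroundStateAverageLRO`).
It provides the one concrete member of the restated engine class (crux 2R: hypotheses (U1) (N) (A) (C) PLUS
(R) time-reflection Hermiticity `c (n ∘ R) = conj (c (−n))` and (P) inversion evenness `c (n ∘ P) = c n`) that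
the negative lemmas of this lane instantiate — the all-pairs REAL XY window table with coefficient `a`,

  `xyPair[r, a] = Σ_{(w,w') ∈ W_r × W_r} a • (δ_0 − δ_{e_w − e_{w'}})`,  `F(φ) = a Σ_{w,w'} (1 − e^{i(φ_w − φ_{w'})})`

(an informal NAME used in the docstrings only — the term is spelled out in every statement: NO definition or notation is
introduced, nothing asserts a `Theses` decl).

* `xyPair_U1`, `xyPair_N`, `xyPair_A` (budget `a · |W_r × W_r| · (1+e²) = a r⁶ (1+e²)`), `xyPair_C`
  (EQUALITY in (C) with `c₀ = a`), `genF_xyPair` (closed form of `F`);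
* `xyPair_comp_equiv` — invariance under EVERY relabelling of the window — with evenness `xyPair_neg` and
  reality `conj_xyPair`, whence `xyPair_R` and `xyPair_P` in the crux's literal form;
* `engineR_hypotheses_satisfiable` — the six hypotheses of `BirComplexStableXYR` are simultaneously
  satisfiable at admissible parameters (`r = 2`, `c₀ = 1`, `B = 64(1+e²)`): the restated engine is not a
  statement about the empty class (so crux 4R is not target-equivalent by emptiness of the class).

The (U1)/(N)/(A)/(C) bookkeeping is adapted from the rev-0 work file `Cruxes/BirGappedPhaseReduction/Disproof.lean`
§3c (cdisprove on stmt-2082, `xyTable`); the symmetry half is new.  Standing disprover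
refuter-cdisprove-stmt-HubbardSuperconductivity-14846-0, 2026-08-16; work file `Cruxes/BirGappedPhaseReductionR/Disproof.lean`.
[folklore]
-/

noncomputable section

namespace Summit.HubbardSuperconductivity.HubbardSuperconductivity.Theorems.BirGappedPhaseReductionR.Negative

open scoped BigOperators ComplexConjugate
open MeasureTheory Complex Set Literature.Probability.LatticeModels
open Summit.HubbardSuperconductivity.BirComplexStableXYNegative

variable {r : ℕ}

/-! ### §1 Admissibility: (U1), (N), (A), (C) -/

/-- linear functionals of the table. [folklore] -/
theorem xyPair_sum_mul (a : ℝ) (g : Freq r → ℂ) :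
    ((∑ p : W r × W r, ((a : ℝ) : ℂ) • (Finsupp.single (0 : Freq r) (1 : ℂ) -
      Finsupp.single (Pi.single (Prod.fst p) (1 : ℤ) - Pi.single (Prod.snd p) (1 : ℤ)) (1 : ℂ)) : Table r)).sum (fun n b => b * g n) =
      ∑ p : W r × W r, (a : ℂ) * (g 0 - g (Pi.single p.1 1 - Pi.single p.2 1)) := by
  rw [← Finsupp.sum_finsetSum_index (by simp) (by intros; ring)]
  refine Finset.sum_congr rfl fun p _ => ?_
  rw [Finsupp.sum_smul_index' (by simp),
    Finsupp.sum_sub_index (by intros; simp only [smul_eq_mul]; ring),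
    Finsupp.sum_single_index (by simp), Finsupp.sum_single_index (by simp)]
  simp only [smul_eq_mul]; ring

/-- pointwise values of the table. [folklore] -/
theorem xyPair_apply (a : ℝ) (n : Freq r) :
    ((∑ p : W r × W r, ((a : ℝ) : ℂ) • (Finsupp.single (0 : Freq r) (1 : ℂ) -
      Finsupp.single (Pi.single (Prod.fst p) (1 : ℤ) - Pi.single (Prod.snd p) (1 : ℤ)) (1 : ℂ)) : Table r)) n = ∑ p : W r × W r, (a : ℂ) * ((if n = 0 then 1 else 0) -
      (if n = Pi.single p.1 1 - Pi.single p.2 1 then 1 else 0)) := by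
  rw [Finsupp.finsetSum_apply]
  refine Finset.sum_congr rfl fun p _ => ?_
  simp only [Finsupp.smul_apply, Finsupp.sub_apply, Finsupp.single_apply, smul_eq_mul]
  congr 2 <;> simp [eq_comm]

/-- `Σ_v (δ_w − δ_{w'})(v) = 0`. [folklore] -/
theorem sum_single_sub_single (w w' : W r) :
    ∑ v, (Pi.single w 1 - Pi.single w' 1 : Freq r) v = 0 := by
  simp [Finset.sum_sub_distrib, Finset.sum_pi_single']

/-- `Σ_v δ_u(v) φ_v = φ_u`. [folklore] -/
theorem sum_cast_single_mul (u : W r) (φ : W r → ℝ) :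
    ∑ v, (((Pi.single u (1:ℤ) : Freq r) v : ℤ) : ℝ) * φ v = φ u := by
  rw [Finset.sum_eq_single u]
  · simp
  · intro v _ hv; simp [hv]
  · simp

/-- `Σ_v (δ_w − δ_{w'})(v) φ_v = φ_w − φ_{w'}`. [folklore] -/
theorem sum_cast_single_sub_mul (w w' : W r) (φ : W r → ℝ) :
    ∑ v, (((Pi.single w 1 - Pi.single w' 1 : Freq r) v : ℤ) : ℝ) * φ v = φ w - φ w' := by
  simp only [Pi.sub_apply, Int.cast_sub, sub_mul, Finset.sum_sub_distrib, sum_cast_single_mul]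

/-- (U1): every frequency in the support is charge neutral. [folklore] -/
theorem xyPair_U1 (a : ℝ) : ∀ n ∈ ((∑ p : W r × W r, ((a : ℝ) : ℂ) • (Finsupp.single (0 : Freq r) (1 : ℂ) -
      Finsupp.single (Pi.single (Prod.fst p) (1 : ℤ) - Pi.single (Prod.snd p) (1 : ℤ)) (1 : ℂ)) : Table r)).support, ∑ w, n w = 0 := by
  intro n hn
  by_contra hne
  rw [Finsupp.mem_support_iff] at hn
  apply hn
  rw [xyPair_apply]
  refine Finset.sum_eq_zero fun p _ => ?_
  have h0 : n ≠ 0 := by rintro rfl; simp at hne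
  have h1 : n ≠ Pi.single p.1 1 - Pi.single p.2 1 := by
    rintro rfl; exact hne (sum_single_sub_single p.1 p.2)
  simp [h0, h1]

/-- (N): the coefficients sum to zero. [folklore] -/
theorem xyPair_N (a : ℝ) : ((∑ p : W r × W r, ((a : ℝ) : ℂ) • (Finsupp.single (0 : Freq r) (1 : ℂ) -
      Finsupp.single (Pi.single (Prod.fst p) (1 : ℤ) - Pi.single (Prod.snd p) (1 : ℤ)) (1 : ℂ)) : Table r)).sum (fun _ b => b) = 0 := by
  have h := xyPair_sum_mul (r := r) a (fun _ => (1 : ℂ))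
  simp only [mul_one, sub_self, mul_zero, Finset.sum_const_zero] at h
  exact h

/-- the generating function of the table: `F(φ) = a Σ_p (1 − e^{i(φ_{p.1} − φ_{p.2})})`. [folklore] -/
theorem genF_xyPair (a : ℝ) (φ : W r → ℝ) :
    genF ((∑ p : W r × W r, ((a : ℝ) : ℂ) • (Finsupp.single (0 : Freq r) (1 : ℂ) -
      Finsupp.single (Pi.single (Prod.fst p) (1 : ℤ) - Pi.single (Prod.snd p) (1 : ℤ)) (1 : ℂ)) : Table r)) φ = (a : ℂ) * ∑ p : W r × W r, (1 - cexp (I * ((φ p.1 - φ p.2 : ℝ) : ℂ))) := by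
  unfold genF
  rw [xyPair_sum_mul, Finset.mul_sum]
  refine Finset.sum_congr rfl fun p _ => ?_
  simp only [sum_cast_single_sub_mul, Pi.zero_apply, Int.cast_zero, zero_mul,
    Finset.sum_const_zero, Complex.ofReal_zero, mul_zero, Complex.exp_zero]

/-- (C) with EQUALITY: `Re F(φ) = a Σ_{w,w'} (1 − cos(φ_w − φ_{w'}))`. [folklore] -/
theorem xyPair_C (a : ℝ) (φ : W r → ℝ) :
    a * ∑ w, ∑ w', (1 - Real.cos (φ w - φ w')) = (genF ((∑ p : W r × W r, ((a : ℝ) : ℂ) • (Finsupp.single (0 : Freq r) (1 : ℂ) -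
      Finsupp.single (Pi.single (Prod.fst p) (1 : ℤ) - Pi.single (Prod.snd p) (1 : ℤ)) (1 : ℂ)) : Table r)) φ).re := by
  have key : ∀ p : W r × W r, ((a : ℂ) * (1 - cexp (I * ((φ p.1 - φ p.2 : ℝ) : ℂ)))).re
      = a * (1 - Real.cos (φ p.1 - φ p.2)) := by
    intro p
    have h : cexp (I * ((φ p.1 - φ p.2 : ℝ) : ℂ)) =
        (Real.cos (φ p.1 - φ p.2) : ℂ) + (Real.sin (φ p.1 - φ p.2) : ℂ) * I := by
      rw [mul_comm, Complex.exp_mul_I, Complex.ofReal_cos, Complex.ofReal_sin]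
    rw [h]
    simp only [Complex.mul_re, Complex.sub_re, Complex.add_re, Complex.one_re, Complex.ofReal_re,
      Complex.ofReal_im, Complex.mul_im, Complex.I_re, Complex.I_im, Complex.sub_im, Complex.add_im,
      Complex.one_im]
    ring
  calc a * ∑ w, ∑ w', (1 - Real.cos (φ w - φ w'))
        = ∑ w, ∑ w', a * (1 - Real.cos (φ w - φ w')) := by simp only [Finset.mul_sum]
    _ = ∑ p : W r × W r, a * (1 - Real.cos (φ p.1 - φ p.2)) :=
        (Fintype.sum_prod_type' (fun w w' => a * (1 - Real.cos (φ w - φ w')))).symm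
    _ = _ := by
        rw [genF_xyPair, Finset.mul_sum, Complex.re_sum]
        exact Finset.sum_congr rfl fun p _ => (key p).symm

/-- `Σ_v |δ_u(v)| = 1`. [folklore] -/
theorem sum_abs_cast_single (u : W r) :
    ∑ v, |((((Pi.single u 1 : Freq r)) v : ℤ) : ℝ)| = 1 := by
  rw [Finset.sum_eq_single u]
  · simp
  · intro v _ hv; simp [hv]
  · simp

/-- `|δ_w − δ_{w'}|₁ ≤ 2`. [folklore] -/
theorem sum_abs_cast_single_sub_le (w w' : W r) :
    ∑ v, |(((Pi.single w 1 - Pi.single w' 1 : Freq r) v : ℤ) : ℝ)| ≤ 2 := by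
  calc ∑ v, |(((Pi.single w 1 - Pi.single w' 1 : Freq r) v : ℤ) : ℝ)|
        ≤ ∑ v, (|((((Pi.single w 1 : Freq r)) v : ℤ) : ℝ)| + |((((Pi.single w' 1 : Freq r)) v : ℤ) : ℝ)|) := by
          refine Finset.sum_le_sum fun v _ => ?_
          rw [Pi.sub_apply, Int.cast_sub]
          exact abs_sub _ _
    _ = 2 := by rw [Finset.sum_add_distrib, sum_abs_cast_single, sum_abs_cast_single]; norm_num

/-- one term of the table has weighted norm `≤ a (1 + e²)`. [folklore] -/
theorem normA_xyPair_term_le (a : ℝ) (ha : 0 ≤ a) (p : W r × W r) :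
    normA (((a : ℝ) : ℂ) • (Finsupp.single (0 : Freq r) (1 : ℂ) -
      Finsupp.single (Pi.single (Prod.fst p) (1 : ℤ) - Pi.single (Prod.snd p) (1 : ℤ)) (1 : ℂ))) ≤
      a * (1 + Real.exp 2) := by
  rw [normA_smul, Complex.norm_real, Real.norm_of_nonneg ha, sub_eq_add_neg, ← Finsupp.single_neg]
  refine mul_le_mul_of_nonneg_left ((normA_add_le _ _).trans ?_) ha
  rw [normA_single, normA_single]
  have e0 : ‖(1 : ℂ)‖ * Real.exp (∑ w, |(((0 : Freq r) w : ℤ) : ℝ)|) = 1 := by simp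
  have e1 : ‖(-1 : ℂ)‖ * Real.exp (∑ w, |(((Pi.single p.1 1 - Pi.single p.2 1 : Freq r) w : ℤ) : ℝ)|) ≤
      Real.exp 2 := by
    rw [norm_neg, norm_one, one_mul]
    exact Real.exp_le_exp.mpr (sum_abs_cast_single_sub_le p.1 p.2)
  linarith

/-- subadditivity of the weighted norm over the pairs. [folklore] -/
theorem normA_xyPair_le_sum (a : ℝ) : normA ((∑ p : W r × W r, ((a : ℝ) : ℂ) • (Finsupp.single (0 : Freq r) (1 : ℂ) -
      Finsupp.single (Pi.single (Prod.fst p) (1 : ℤ) - Pi.single (Prod.snd p) (1 : ℤ)) (1 : ℂ)) : Table r)) ≤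
    ∑ p : W r × W r, normA (((a : ℝ) : ℂ) • (Finsupp.single (0 : Freq r) (1 : ℂ) -
      Finsupp.single (Pi.single (Prod.fst p) (1 : ℤ) - Pi.single (Prod.snd p) (1 : ℤ)) (1 : ℂ))) :=
  Finset.le_sum_of_subadditive normA normA_zero.le normA_add_le _ _

/-- `Σ_p a(1+e²) = a |W_r × W_r| (1+e²)`. [folklore] -/
theorem sum_const_pairs (a : ℝ) :
    (∑ _p : W r × W r, a * (1 + Real.exp 2)) = a * Fintype.card (W r × W r) * (1 + Real.exp 2) := by
  rw [Finset.sum_const, Finset.card_univ, nsmul_eq_mul]; ring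

/-- (A): the exponentially weighted `ℓ¹` norm of the table (the functional `normA` of hypothesis (A), i.e.
`c.sum (fun n a => ‖a‖ e^{|n|₁})`) is at most `a · |W_r × W_r| · (1 + e²)`. [folklore] -/
theorem xyPair_A (a : ℝ) (ha : 0 ≤ a) :
    normA ((∑ p : W r × W r, ((a : ℝ) : ℂ) • (Finsupp.single (0 : Freq r) (1 : ℂ) -
      Finsupp.single (Pi.single (Prod.fst p) (1 : ℤ) - Pi.single (Prod.snd p) (1 : ℤ)) (1 : ℂ)) : Table r)) ≤ a * Fintype.card (W r × W r) * (1 + Real.exp 2) :=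
  le_trans (normA_xyPair_le_sum a)
    (le_trans (Finset.sum_le_sum fun p _ => normA_xyPair_term_le a ha p) (le_of_eq (sum_const_pairs a)))

/-! ### §2 Symmetries: relabelling invariance, evenness, reality ⇒ (R) and (P) -/

/-- precomposition of a pair frequency with a relabelling of the window. [folklore] -/
theorem single_sub_single_comp_equiv (σ : W r ≃ W r) (u v : W r) :
    (Pi.single u 1 - Pi.single v 1 : Freq r) ∘ σ = Pi.single (σ.symm u) 1 - Pi.single (σ.symm v) 1 := by
  ext w
  simp only [Function.comp_apply, Pi.sub_apply, Pi.single_apply, Equiv.apply_eq_iff_eq_symm_apply]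

/-- `n ∘ σ = m ↔ n = m ∘ σ⁻¹`. [folklore] -/
theorem comp_equiv_eq_iff (σ : W r ≃ W r) (n m : Freq r) : n ∘ σ = m ↔ n = m ∘ σ.symm := by
  constructor
  · rintro rfl; ext w; simp
  · rintro rfl; ext w; simp

/-- the all-pairs table is invariant under EVERY relabelling of the window. [folklore] -/
theorem xyPair_comp_equiv (σ : W r ≃ W r) (a : ℝ) (n : Freq r) :
    ((∑ p : W r × W r, ((a : ℝ) : ℂ) • (Finsupp.single (0 : Freq r) (1 : ℂ) -
      Finsupp.single (Pi.single (Prod.fst p) (1 : ℤ) - Pi.single (Prod.snd p) (1 : ℤ)) (1 : ℂ)) : Table r)) (n ∘ σ) = ((∑ p : W r × W r, ((a : ℝ) : ℂ) • (Finsupp.single (0 : Freq r) (1 : ℂ) -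
      Finsupp.single (Pi.single (Prod.fst p) (1 : ℤ) - Pi.single (Prod.snd p) (1 : ℤ)) (1 : ℂ)) : Table r)) n := by
  rw [xyPair_apply, xyPair_apply]
  have h0 : (n ∘ σ = 0) ↔ n = 0 := by
    constructor
    · intro h; funext w; simpa using congrFun h (σ.symm w)
    · rintro rfl; rfl
  have h1 : ∀ p : W r × W r, (n ∘ σ = Pi.single p.1 1 - Pi.single p.2 1) ↔
      n = Pi.single (σ p.1) 1 - Pi.single (σ p.2) 1 := by
    intro p
    rw [comp_equiv_eq_iff, single_sub_single_comp_equiv, Equiv.symm_symm]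
  simp_rw [h0, h1]
  exact Fintype.sum_equiv (Equiv.prodCongr σ σ) _ _ (fun p => rfl)

/-- the table is even in the frequency. [folklore] -/
theorem xyPair_neg (a : ℝ) (n : Freq r) : ((∑ p : W r × W r, ((a : ℝ) : ℂ) • (Finsupp.single (0 : Freq r) (1 : ℂ) -
      Finsupp.single (Pi.single (Prod.fst p) (1 : ℤ) - Pi.single (Prod.snd p) (1 : ℤ)) (1 : ℂ)) : Table r)) (-n) = ((∑ p : W r × W r, ((a : ℝ) : ℂ) • (Finsupp.single (0 : Freq r) (1 : ℂ) -
      Finsupp.single (Pi.single (Prod.fst p) (1 : ℤ) - Pi.single (Prod.snd p) (1 : ℤ)) (1 : ℂ)) : Table r)) n := by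
  rw [xyPair_apply, xyPair_apply]
  have h1 : ∀ p : W r × W r, (-n = Pi.single p.1 1 - Pi.single p.2 1) ↔
      n = Pi.single p.2 1 - Pi.single p.1 1 := by
    intro p; rw [neg_eq_iff_eq_neg, neg_sub]
  simp_rw [neg_eq_zero, h1]
  exact Fintype.sum_equiv (Equiv.prodComm _ _) _ _ (fun p => rfl)

/-- the table is real. [folklore] -/
theorem conj_xyPair (a : ℝ) (n : Freq r) : conj (((∑ p : W r × W r, ((a : ℝ) : ℂ) • (Finsupp.single (0 : Freq r) (1 : ℂ) -
      Finsupp.single (Pi.single (Prod.fst p) (1 : ℤ) - Pi.single (Prod.snd p) (1 : ℤ)) (1 : ℂ)) : Table r)) n) = ((∑ p : W r × W r, ((a : ℝ) : ℂ) • (Finsupp.single (0 : Freq r) (1 : ℂ) -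
      Finsupp.single (Pi.single (Prod.fst p) (1 : ℤ) - Pi.single (Prod.snd p) (1 : ℤ)) (1 : ℂ)) : Table r)) n := by
  rw [xyPair_apply, map_sum]
  refine Finset.sum_congr rfl fun p _ => ?_
  rw [map_mul, Complex.conj_ofReal, map_sub]
  congr 2 <;> split_ifs <;> simp

/-- (R) time-reflection (Osterwalder–Schrader) Hermiticity of the table, in the crux's literal form
`c (n ∘ R) = conj (c (−n))`, `R (w₁, w₂, w₃) = (w₁, w₂, rev w₃)`. [folklore] -/
theorem xyPair_R (a : ℝ) : ∀ n : Freq r,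
    ((∑ p : W r × W r, ((a : ℝ) : ℂ) • (Finsupp.single (0 : Freq r) (1 : ℂ) -
      Finsupp.single (Pi.single (Prod.fst p) (1 : ℤ) - Pi.single (Prod.snd p) (1 : ℤ)) (1 : ℂ)) : Table r)) (fun w => n (w.1, w.2.1, Fin.rev w.2.2)) = (starRingEnd ℂ) (((∑ p : W r × W r, ((a : ℝ) : ℂ) • (Finsupp.single (0 : Freq r) (1 : ℂ) -
      Finsupp.single (Pi.single (Prod.fst p) (1 : ℤ) - Pi.single (Prod.snd p) (1 : ℤ)) (1 : ℂ)) : Table r)) (-n)) := by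
  intro n
  rw [xyPair_neg, conj_xyPair]
  exact xyPair_comp_equiv ⟨fun w => (w.1, w.2.1, Fin.rev w.2.2), fun w => (w.1, w.2.1, Fin.rev w.2.2),
    fun w => by simp, fun w => by simp⟩ a n

/-- (P) inversion evenness of the table, in the crux's literal form `c (n ∘ P) = c n`,
`P (w₁, w₂, w₃) = (rev w₁, rev w₂, w₃)`. [folklore] -/
theorem xyPair_P (a : ℝ) : ∀ n : Freq r,
    ((∑ p : W r × W r, ((a : ℝ) : ℂ) • (Finsupp.single (0 : Freq r) (1 : ℂ) -
      Finsupp.single (Pi.single (Prod.fst p) (1 : ℤ) - Pi.single (Prod.snd p) (1 : ℤ)) (1 : ℂ)) : Table r)) (fun w => n (Fin.rev w.1, Fin.rev w.2.1, w.2.2)) = ((∑ p : W r × W r, ((a : ℝ) : ℂ) • (Finsupp.single (0 : Freq r) (1 : ℂ) -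
      Finsupp.single (Pi.single (Prod.fst p) (1 : ℤ) - Pi.single (Prod.snd p) (1 : ℤ)) (1 : ℂ)) : Table r)) n :=
  fun n => xyPair_comp_equiv ⟨fun w => (Fin.rev w.1, Fin.rev w.2.1, w.2.2),
    fun w => (Fin.rev w.1, Fin.rev w.2.1, w.2.2), fun w => by simp, fun w => by simp⟩ a n

/-! ### §3 The restated engine class is inhabited -/

/-- The six hypotheses of `BirComplexStableXYR` — (U1), (N), (A), (C), (R), (P) — are SIMULTANEOUSLY
SATISFIABLE at admissible parameters (`r = 2`, `c₀ = 1`, `B = 64(1+e²)`), by the all-pairs real XY window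
table: the restated engine quantifies over a non-empty class. [folklore] -/
theorem engineR_hypotheses_satisfiable :
    ∃ (r : ℕ) (B c₀ : ℝ) (c : ((Fin r × Fin r × Fin r) → ℤ) →₀ ℂ), 2 ≤ r ∧ 0 < c₀ ∧
      (∀ n ∈ c.support, ∑ w, n w = 0) ∧
      c.sum (fun _ a => a) = 0 ∧
      c.sum (fun n a => ‖a‖ * Real.exp (∑ w, |(n w : ℝ)|)) ≤ B ∧
      (∀ φ : (Fin r × Fin r × Fin r) → ℝ, c₀ * ∑ w, ∑ w', (1 - Real.cos (φ w - φ w')) ≤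
        ((fun (φ : (Fin r × Fin r × Fin r) → ℝ) => c.sum (fun n a => a * Complex.exp (Complex.I *
          ((∑ w, (n w : ℝ) * φ w : ℝ) : ℂ)))) φ).re) ∧
      (∀ n : (Fin r × Fin r × Fin r) → ℤ, c (fun w => n (w.1, w.2.1, Fin.rev w.2.2)) =
        (starRingEnd ℂ) (c (-n))) ∧
      (∀ n : (Fin r × Fin r × Fin r) → ℤ, c (fun w => n (Fin.rev w.1, Fin.rev w.2.1, w.2.2)) = c n) := by
  -- Work at a variable side `r` with `r = 2`, and name every component BEFORE assembling the tuple: the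
  -- table is a large explicit term, and unifying two elaborations of it while instance problems are still
  -- pending is needlessly deep.
  obtain ⟨r, hr⟩ : ∃ r : ℕ, r = 2 := ⟨2, rfl⟩
  have hcard : (Fintype.card (W r × W r) : ℝ) = 64 := by
    subst hr; simp only [Fintype.card_prod, Fintype.card_fin]; norm_num
  have hU1 := xyPair_U1 (r := r) 1
  have hN := xyPair_N (r := r) 1
  have hA : normA ((∑ p : W r × W r, ((1 : ℝ) : ℂ) • (Finsupp.single (0 : Freq r) (1 : ℂ) -
      Finsupp.single (Pi.single (Prod.fst p) (1 : ℤ) - Pi.single (Prod.snd p) (1 : ℤ)) (1 : ℂ)) : Table r)) ≤ 64 * (1 + Real.exp 2) :=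
    (xyPair_A (r := r) 1 zero_le_one).trans (le_of_eq (by rw [hcard]; ring))
  have hC : ∀ φ : W r → ℝ, 1 * ∑ w, ∑ w', (1 - Real.cos (φ w - φ w')) ≤ (genF ((∑ p : W r × W r, ((1 : ℝ) : ℂ) • (Finsupp.single (0 : Freq r) (1 : ℂ) -
      Finsupp.single (Pi.single (Prod.fst p) (1 : ℤ) - Pi.single (Prod.snd p) (1 : ℤ)) (1 : ℂ)) : Table r)) φ).re :=
    fun φ => le_of_eq (xyPair_C 1 φ)
  have hR := xyPair_R (r := r) 1
  have hP := xyPair_P (r := r) 1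
  exact ⟨r, _, 1, _, hr.ge, one_pos, hU1, hN, hA, hC, hR, hP⟩

end Summit.HubbardSuperconductivity.HubbardSuperconductivity.Theorems.BirGappedPhaseReductionR.Negative
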